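import Summits.AtomisticToContinuum.Crystallization.Theorems.FrustratedLawDichotomyStrainedPatchHomParamTransfer
import Summits.AtomisticToContinuum.Crystallization.Theorems.FrustratedLawDichotomyStrainedPatchHomEntryFitHcpCentredSqRobust
import Summits.AtomisticToContinuum.Crystallization.Theorems.FrustratedLawDichotomyStrainedPatchHomEntrySemanticQuot

/-!
# The FAT LEAF (node 89 V-b / node 90 PT-3): a thin-box robust fit certificate + a ξ-collar test certify a FAT box in the quotient currency

decomp-a2c hand-2 g40 — structural share for the crux `AperiodicFrustratedLawGap` (stmt-AtomisticToContinuum-27623; `(H) HomFloor`, hcp half),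
the port item PT-3 of lens-5's NODE 90 «ParamTransfer» (memo NODE-g90 §3, «hand-2; all bookkeeping — new files only»), on top of the three landed
pieces: `…HomParamTransfer` (p854325: `HcpFitCoreRobust`, `hcpLeafGoal_of_collar_coord`), `…HomEntryFitHcpCentredSqRobust` (p854324: the kit
`fitOKHDCRSρ c w q ρS e0S` and `fitOKHDCRSρ_sound`) and NODE 88's quotient currency `…HomEntrySemanticQuot` (`semOKHQ`, `semOKHQ_of_sound`).

THE LEAF.  Data: a THIN box `(c₀, w₀)` (same grammar `(Fin 3 × Fin 3) ⊕ Fin 3 → ℤ`, scale `SC`), a pattern rotation index `q`, a collar radius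
`ρS` and a residual budget `e0S` (integers, scale `SC`).  On a leaf box `(c, w)` the Boolean `fatLeafOK c₀ w₀ q ρS e0S c w` checks
(i) `uContained`: the nine `U`-entry intervals of `(c, w)` lie inside those of `(c₀, w₀)`;
(ii) `xiCollarOK`: `0 ≤ w₀` on the three shuffle coordinates and `25·Σᵢ Δᵢ² ≤ 16·ρS²` with `Δᵢ := (|cᵢ − c₀ᵢ| + wᵢ − w₀ᵢ)₊` — every shuffle of the
fat box is within `Σ Δᵢ²` (squared, scale `SC²`) of the thin shuffle box, and `(1 + 1/4)·√(Σ Δᵢ²) ≤ ρS` (the strain factor `1 + ‖U − 1‖ ≤ 5/4` of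
the window);
(iii) `fitOKHDCRSρ c₀ w₀ q ρS e0S`: the robust fit certificate on the THIN box.
Soundness `semOKHQ_of_fatLeafOK`: then `semOKHQ μ c w = true` at EVERY level `μ` (goodness disjunct; `hcpLeafGoal_of_collar_coord` at `κ = 1/4` with
`T` = the thin shuffle box, the collar point being the coordinatewise CLAMP of `ξ'` into `T`).  A fat cell therefore enters the manifests of record as a
LISTED fact (`colLeaf5Q` kind `inl i` / `…HomCutTreeFacts.facts_cons`) — no new menu is needed; `semFactsQ_of_fatLeaves` certifies a whole list of fat
cells over one thin certificate by ONE `decide`.  (ParamTransfer's cone / cone-of-collars leaves, V-c, are the same bookkeeping over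
`hcpLeafGoal_of_cone(_collar)` and are left for the next port once FATPRICE-90 prices them.)

NO new real-side estimate (pure bookkeeping over the three landed theorems); 0 sorry; standard axioms; no instances / notation / `#eval`.
`--supports stmt-AtomisticToContinuum-27623`.
-/

noncomputable section

namespace Summit.AtomisticToContinuum.Crystallization.Theorems.FrustratedLawDichotomyStrainedPatchHomEntryFitHcpFatLeaf

open scoped BigOperators RealInnerProductSpace
open Literature.Analysis.ValidatedNumerics.Numerics
open Summit.AtomisticToContinuum.Crystallization.Theorems.ChargedEnergyGapNegative (E3)
open Summit.AtomisticToContinuum.Crystallization.Theorems.FrustratedLawDichotomyStrainedPatchHomEntryHcpFrame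
open Summit.AtomisticToContinuum.Crystallization.Theorems.FrustratedLawDichotomyStrainedPatchHomEntryLeafHT (HcpLeafGoal)
open Summit.AtomisticToContinuum.Crystallization.Theorems.FrustratedLawDichotomyStrainedPatchHomParamTransfer (HcpFitCoreRobust hcpLeafGoal_of_collar_coord)
open Summit.AtomisticToContinuum.Crystallization.Theorems.FrustratedLawDichotomyStrainedPatchHomEntryFitHcpKit (dEnclH)
open Summit.AtomisticToContinuum.Crystallization.Theorems.FrustratedLawDichotomyStrainedPatchHomEntryFitHcpCentred (fitOKHDCRSρ fitOKHDCRSρ_sound)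
open Summit.AtomisticToContinuum.Crystallization.Theorems.FrustratedLawDichotomyStrainedPatchHomEntrySemanticQuot (semOKHQ semOKHQ_of_sound)

/-! ## §1. The Boolean leaf -/

/-- (i) `U`-containment: the nine entry intervals of the leaf box `(c, w)` lie inside those of the thin box `(c₀, w₀)`. -/
def uContained (c₀ w₀ c w : (Fin 3 × Fin 3) ⊕ Fin 3 → ℤ) : Bool :=
  (List.finRange 3).all fun a => (List.finRange 3).all fun b =>
    decide (c₀ (Sum.inl (a, b)) - w₀ (Sum.inl (a, b)) ≤ c (Sum.inl (a, b)) - w (Sum.inl (a, b))) &&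
      decide (c (Sum.inl (a, b)) + w (Sum.inl (a, b)) ≤ c₀ (Sum.inl (a, b)) + w₀ (Sum.inl (a, b)))

/-- The collar excess of shuffle coordinate `i`: `Δᵢ := (|cᵢ − c₀ᵢ| + wᵢ − w₀ᵢ)₊` (scale `SC`) — the largest distance of a point of the leaf's
`ξᵢ`-interval from the thin `ξᵢ`-interval. -/
def xiDelta (c₀ w₀ c w : (Fin 3 × Fin 3) ⊕ Fin 3 → ℤ) (i : Fin 3) : ℤ :=
  max 0 (|c (Sum.inr i) - c₀ (Sum.inr i)| + w (Sum.inr i) - w₀ (Sum.inr i))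

/-- (ii) the ξ-collar test: thin shuffle half-widths `≥ 0` and `25·Σᵢ Δᵢ² ≤ 16·ρS²` (i.e. `(5/4)·√(Σ Δᵢ²) ≤ ρS`). -/
def xiCollarOK (c₀ w₀ : (Fin 3 × Fin 3) ⊕ Fin 3 → ℤ) (ρS : ℤ) (c w : (Fin 3 × Fin 3) ⊕ Fin 3 → ℤ) : Bool :=
  ((List.finRange 3).all fun i => decide (0 ≤ w₀ (Sum.inr i))) &&
    decide (25 * ∑ i : Fin 3, xiDelta c₀ w₀ c w i ^ 2 ≤ 16 * ρS ^ 2)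

/-- ★ **THE FAT LEAF** `fatLeafOK c₀ w₀ q ρS e0S c w`: `U`-containment ∧ ξ-collar ∧ the robust thin-box certificate `fitOKHDCRSρ c₀ w₀ q ρS e0S`.
Computable; one `decide` per leaf. -/
def fatLeafOK (c₀ w₀ : (Fin 3 × Fin 3) ⊕ Fin 3 → ℤ) (q : Fin 4 → ℤ) (ρS e0S : ℤ) (c w : (Fin 3 × Fin 3) ⊕ Fin 3 → ℤ) : Bool :=
  uContained c₀ w₀ c w && xiCollarOK c₀ w₀ ρS c w && fitOKHDCRSρ c₀ w₀ q ρS e0S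

/-! ## §2. Real consequences of the integer tests -/

/-- Reading `uContained`. [formal bookkeeping] -/
theorem uContained_spec {c₀ w₀ c w : (Fin 3 × Fin 3) ⊕ Fin 3 → ℤ} (h : uContained c₀ w₀ c w = true) (ab : Fin 3 × Fin 3) :
    c₀ (Sum.inl ab) - w₀ (Sum.inl ab) ≤ c (Sum.inl ab) - w (Sum.inl ab) ∧ c (Sum.inl ab) + w (Sum.inl ab) ≤ c₀ (Sum.inl ab) + w₀ (Sum.inl ab) := by
  obtain ⟨a, b⟩ := ab
  simp only [uContained, List.all_eq_true, List.mem_finRange, true_implies, Bool.and_eq_true, decide_eq_true_eq] at h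
  exact h a b

/-- A contained entry interval transfers the box membership of an entry. [arithmetic] -/
theorem abs_le_of_contained {x : ℝ} {c w c₀ w₀ : ℤ} (hx : |x - (c : ℝ) / SC| ≤ (w : ℝ) / SC) (h1 : c₀ - w₀ ≤ c - w) (h2 : c + w ≤ c₀ + w₀) :
    |x - (c₀ : ℝ) / SC| ≤ (w₀ : ℝ) / SC := by
  have hS : (0 : ℝ) < SC := SC_pos
  have h1' : ((c₀ : ℝ) - w₀) / SC ≤ ((c : ℝ) - w) / SC := div_le_div_of_nonneg_right (by exact_mod_cast h1) hS.le
  have h2' : ((c : ℝ) + w) / SC ≤ ((c₀ : ℝ) + w₀) / SC := div_le_div_of_nonneg_right (by exact_mod_cast h2) hS.le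
  rw [abs_le] at hx ⊢
  rw [sub_div] at h1'
  rw [add_div, add_div] at h2'
  rw [sub_div] at h1'
  constructor <;> linarith [hx.1, hx.2]

/-- ★ **THE CLAMP** (one coordinate, reals): `x` with `|x − c| ≤ w`, a target interval `[c₀ − w₀, c₀ + w₀]` with `0 ≤ w₀`; the clamp
`t := max (c₀ − w₀) (min (c₀ + w₀) x)` lies in the target interval and `|x − t| ≤ (|c − c₀| + w − w₀)₊`. [arithmetic] -/
theorem clamp_spec {x c w c₀ w₀ : ℝ} (hx : |x - c| ≤ w) (hw₀ : 0 ≤ w₀) :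
    |max (c₀ - w₀) (min (c₀ + w₀) x) - c₀| ≤ w₀ ∧ |x - max (c₀ - w₀) (min (c₀ + w₀) x)| ≤ max 0 (|c - c₀| + w - w₀) := by
  rw [abs_le] at hx
  have hM : 0 ≤ max 0 (|c - c₀| + w - w₀) := le_max_left _ _
  have hD : |c - c₀| + w - w₀ ≤ max 0 (|c - c₀| + w - w₀) := le_max_right _ _
  have hcc := abs_le.1 (le_refl |c - c₀|)
  rcases le_total x (c₀ - w₀) with hlo | hlo
  · -- below the interval: clamp = c₀ − w₀
    have hmin : min (c₀ + w₀) x = x := min_eq_right (by linarith)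
    rw [hmin, max_eq_left hlo]
    refine ⟨abs_le.2 ⟨by linarith, by linarith⟩, abs_le.2 ⟨by linarith, ?_⟩⟩
    have : c₀ - x ≤ |c - c₀| + w := by
      have h1 : c - c₀ ≤ |c - c₀| := le_abs_self _
      have h2 : c₀ - c ≤ |c - c₀| := by rw [abs_sub_comm]; exact le_abs_self _
      linarith
    linarith
  rcases le_total (c₀ + w₀) x with hhi | hhi
  · -- above the interval: clamp = c₀ + w₀
    have hmin : min (c₀ + w₀) x = c₀ + w₀ := min_eq_left hhi
    rw [hmin, max_eq_right (by linarith)]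
    refine ⟨abs_le.2 ⟨by linarith, by linarith⟩, abs_le.2 ⟨?_, by linarith⟩⟩
    have : x - c₀ ≤ |c - c₀| + w := by
      have h1 : c - c₀ ≤ |c - c₀| := le_abs_self _
      linarith
    linarith
  · -- inside: clamp = x
    have hmin : min (c₀ + w₀) x = x := min_eq_right hhi
    rw [hmin, max_eq_right hlo]
    exact ⟨abs_le.2 ⟨by linarith, by linarith⟩, by simp⟩

/-- Reading `xiCollarOK`: nonnegative thin shuffle half-widths and the squared collar budget over the reals. [formal bookkeeping] -/
theorem xiCollarOK_spec {c₀ w₀ c w : (Fin 3 × Fin 3) ⊕ Fin 3 → ℤ} {ρS : ℤ} (h : xiCollarOK c₀ w₀ ρS c w = true) :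
    (∀ i : Fin 3, (0 : ℤ) ≤ w₀ (Sum.inr i)) ∧ 25 * ∑ i : Fin 3, ((xiDelta c₀ w₀ c w i : ℤ) : ℝ) ^ 2 ≤ 16 * ((ρS : ℤ) : ℝ) ^ 2 := by
  simp only [xiCollarOK, List.all_eq_true, List.mem_finRange, true_implies, Bool.and_eq_true, decide_eq_true_eq] at h
  refine ⟨h.1, ?_⟩
  have := h.2
  exact_mod_cast this

/-! ## §3. ★★ Soundness: the fat leaf certifies its box in the quotient currency (and in the old one) -/

/-- The `hver`-shape core: a fat-leaf verdict gives the hcp leaf goal at every admissible `(U, ξ')` of the leaf box, at every level.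
[bookkeeping over `fitOKHDCRSρ_sound` + `hcpLeafGoal_of_collar_coord`] -/
theorem hcpLeafGoal_of_fatLeafOK {c₀ w₀ c w : (Fin 3 × Fin 3) ⊕ Fin 3 → ℤ} {q : Fin 4 → ℤ} {ρS e0S : ℤ}
    (h : fatLeafOK c₀ w₀ q ρS e0S c w = true) (U : E3 →L[ℝ] E3) (ξ' : E3) (hsa : ∀ v v' : E3, ⟪U v, v'⟫ = ⟪v, U v'⟫)
    (hU : ‖U - 1‖ ≤ 1 / 4) (hξ' : ‖ξ'‖ ≤ 1 / 4)
    (hbox : ∀ ab : Fin 3 × Fin 3, |(U (EuclideanSpace.single ab.2 (1 : ℝ))) ab.1 - (c (Sum.inl ab) : ℝ) / SC| ≤ (w (Sum.inl ab) : ℝ) / SC)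
    (hξb : ∀ i : Fin 3, |ξ' i - (c (Sum.inr i) : ℝ) / SC| ≤ (w (Sum.inr i) : ℝ) / SC) (μ : ℤ) : HcpLeafGoal μ U ξ' := by
  simp only [fatLeafOK, Bool.and_eq_true] at h
  obtain ⟨⟨hUc, hcol⟩, hfit⟩ := h
  obtain ⟨hw₀, hbud⟩ := xiCollarOK_spec hcol
  have hS : (0 : ℝ) < SC := SC_pos
  -- `U` lies in the thin `U`-box
  have hbox₀ : ∀ ab : Fin 3 × Fin 3,
      |(U (EuclideanSpace.single ab.2 (1 : ℝ))) ab.1 - (c₀ (Sum.inl ab) : ℝ) / SC| ≤ (w₀ (Sum.inl ab) : ℝ) / SC := fun ab =>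
    abs_le_of_contained (hbox ab) (uContained_spec hUc ab).1 (uContained_spec hUc ab).2
  -- the thin shuffle box and the robust certificates on it
  set T : Set E3 := {ξ | ∀ i : Fin 3, |ξ i - (c₀ (Sum.inr i) : ℝ) / SC| ≤ (w₀ (Sum.inr i) : ℝ) / SC} with hT
  have hcert : ∀ ξ ∈ T, ∃ (R : E3 →ₗᵢ[ℝ] E3) (η' dlo dhi e₀ : ℝ), HcpFitCoreRobust U ξ R η' dlo dhi ((ρS : ℝ) / SC) e₀ := by
    intro ξ hξT
    obtain ⟨-, R, hR⟩ := fitOKHDCRSρ_sound hfit U ξ hsa hbox₀ hξT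
    exact ⟨R, 4999 / 100000, ((dEnclH c₀ w₀).lo : ℝ) / SC, ((dEnclH c₀ w₀).hi : ℝ) / SC, (e0S : ℝ) / SC, hR⟩
  -- the clamp of `ξ'` into the thin shuffle box
  set t : Fin 3 → ℝ := fun i =>
    max ((c₀ (Sum.inr i) : ℝ) / SC - (w₀ (Sum.inr i) : ℝ) / SC)
      (min ((c₀ (Sum.inr i) : ℝ) / SC + (w₀ (Sum.inr i) : ℝ) / SC) (ξ' i)) with ht
  set ξ : E3 := (EuclideanSpace.equiv (Fin 3) ℝ).symm t with hξdef
  have hξi : ∀ i : Fin 3, ξ i = t i := fun i => rfl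
  have hcl : ∀ i : Fin 3, |ξ i - (c₀ (Sum.inr i) : ℝ) / SC| ≤ (w₀ (Sum.inr i) : ℝ) / SC ∧
      |ξ' i - ξ i| ≤ ((xiDelta c₀ w₀ c w i : ℤ) : ℝ) / SC := by
    intro i
    have hw₀' : (0 : ℝ) ≤ (w₀ (Sum.inr i) : ℝ) / SC := div_nonneg (by exact_mod_cast hw₀ i) hS.le
    have hcs := clamp_spec (c₀ := (c₀ (Sum.inr i) : ℝ) / SC) (hξb i) hw₀'
    rw [hξi i]
    refine ⟨hcs.1, hcs.2.trans (max_le ?_ ?_)⟩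
    · exact div_nonneg (by exact_mod_cast (le_max_left 0 _ : (0 : ℤ) ≤ xiDelta c₀ w₀ c w i)) hS.le
    · have hD1 : (|(c (Sum.inr i) : ℝ) - c₀ (Sum.inr i)| + w (Sum.inr i) - w₀ (Sum.inr i) : ℝ) ≤ ((xiDelta c₀ w₀ c w i : ℤ) : ℝ) := by
        have := (le_max_right 0 _ : |c (Sum.inr i) - c₀ (Sum.inr i)| + w (Sum.inr i) - w₀ (Sum.inr i) ≤ xiDelta c₀ w₀ c w i)
        have := (Int.cast_le (R := ℝ)).2 this
        push_cast [xiDelta] at this ⊢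
        exact this
      have := div_le_div_of_nonneg_right hD1 hS.le
      calc |(c (Sum.inr i) : ℝ) / SC - (c₀ (Sum.inr i) : ℝ) / SC| + (w (Sum.inr i) : ℝ) / SC - (w₀ (Sum.inr i) : ℝ) / SC
          = (|(c (Sum.inr i) : ℝ) - c₀ (Sum.inr i)| + w (Sum.inr i) - w₀ (Sum.inr i)) / SC := by
            rw [← sub_div, abs_div, abs_of_pos hS]; ring
        _ ≤ _ := this
  have hξT : ξ ∈ T := fun i => (hcl i).1
  -- the squared collar budget: `Σ (ξ' − ξ)ᵢ² ≤ m²`, `(5/4)·m ≤ ρ`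
  set m : ℝ := Real.sqrt (∑ i : Fin 3, ((xiDelta c₀ w₀ c w i : ℤ) : ℝ) ^ 2) / SC with hm
  have hm0 : 0 ≤ m := div_nonneg (Real.sqrt_nonneg _) hS.le
  have hsum0 : 0 ≤ ∑ i : Fin 3, ((xiDelta c₀ w₀ c w i : ℤ) : ℝ) ^ 2 := Finset.sum_nonneg fun i _ => sq_nonneg _
  have hnear : ∑ i, ((ξ' - ξ) i) ^ 2 ≤ m ^ 2 := by
    have hterm : ∀ i : Fin 3, ((ξ' - ξ) i) ^ 2 ≤ (((xiDelta c₀ w₀ c w i : ℤ) : ℝ) / SC) ^ 2 := by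
      intro i
      have h2 : |(ξ' - ξ) i| ≤ ((xiDelta c₀ w₀ c w i : ℤ) : ℝ) / SC := by simpa using (hcl i).2
      obtain ⟨hl, hr⟩ := abs_le.1 h2
      exact sq_le_sq' hl hr
    calc ∑ i, ((ξ' - ξ) i) ^ 2 ≤ ∑ i : Fin 3, (((xiDelta c₀ w₀ c w i : ℤ) : ℝ) / SC) ^ 2 := Finset.sum_le_sum fun i _ => hterm i
      _ = (∑ i : Fin 3, ((xiDelta c₀ w₀ c w i : ℤ) : ℝ) ^ 2) / SC ^ 2 := by
          rw [Finset.sum_div]; exact Finset.sum_congr rfl fun i _ => by ring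
      _ = m ^ 2 := by rw [hm, div_pow, Real.sq_sqrt hsum0]
  have hρS0 : (0 : ℝ) ≤ ρS := by
    obtain ⟨R, η', dlo, dhi, e₀, hR⟩ := hcert ξ hξT
    have h0 : (0 : ℝ) ≤ (ρS : ℝ) / SC := hR.hρ0
    have h1 : (0 : ℝ) ≤ (ρS : ℝ) / SC * SC := mul_nonneg h0 hS.le
    rwa [div_mul_cancel₀ _ (ne_of_gt hS)] at h1
  have hmρ : (1 + 1 / 4) * m ≤ (ρS : ℝ) / SC := by
    -- `25·Σ ≤ 16·ρS²` ⟹ `(5/4)·√Σ ≤ ρS`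
    have hsq : ((5 / 4 : ℝ) * Real.sqrt (∑ i : Fin 3, ((xiDelta c₀ w₀ c w i : ℤ) : ℝ) ^ 2)) ^ 2 ≤ ((ρS : ℤ) : ℝ) ^ 2 := by
      rw [mul_pow, Real.sq_sqrt hsum0]; nlinarith [hbud]
    have h54 : (5 / 4 : ℝ) * Real.sqrt (∑ i : Fin 3, ((xiDelta c₀ w₀ c w i : ℤ) : ℝ) ^ 2) ≤ (ρS : ℝ) :=
      (abs_le_of_sq_le_sq' hsq hρS0).2
    have := div_le_div_of_nonneg_right h54 hS.le
    calc (1 + 1 / 4) * m = (5 / 4 : ℝ) * Real.sqrt (∑ i : Fin 3, ((xiDelta c₀ w₀ c w i : ℤ) : ℝ) ^ 2) / SC := by rw [hm]; ring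
      _ ≤ (ρS : ℝ) / SC := this
  have hξ'2 : ‖ξ'‖ ≤ 1 / 2 := hξ'.trans (by norm_num)
  exact hcpLeafGoal_of_collar_coord hcert hU le_rfl hm0 hmρ ⟨ξ, hξT, hnear⟩ hξ'2 μ

/-- ★★ **SOUNDNESS IN THE QUOTIENT CURRENCY**: a box accepted by the fat leaf is a `semOKHQ` fact at every level `μ`. [formal bookkeeping] -/
theorem semOKHQ_of_fatLeafOK {μ : ℤ} {c₀ w₀ c w : (Fin 3 × Fin 3) ⊕ Fin 3 → ℤ} {q : Fin 4 → ℤ} {ρS e0S : ℤ}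
    (h : fatLeafOK c₀ w₀ q ρS e0S c w = true) : semOKHQ μ c w = true :=
  semOKHQ_of_sound (fatLeafOK c₀ w₀ q ρS e0S)
    (fun _ _ hv U ξ hsa _ hU hξ hbox hξb _ _ => hcpLeafGoal_of_fatLeafOK hv U ξ hsa hU hξ hbox hξb μ) h

/-- A whole LIST of fat cells certified by ONE `decide` of `List.all`: facts for the manifests of record (`…HomCutTreeFacts.facts_of_all_sound` shape).
[formal bookkeeping] -/
theorem semFactsQ_of_fatLeaves {μ : ℤ} {c₀ w₀ : (Fin 3 × Fin 3) ⊕ Fin 3 → ℤ} {q : Fin 4 → ℤ} {ρS e0S : ℤ}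
    {L : List (((Fin 3 × Fin 3) ⊕ Fin 3 → ℤ) × ((Fin 3 × Fin 3) ⊕ Fin 3 → ℤ))}
    (h : (L.all fun b => fatLeafOK c₀ w₀ q ρS e0S b.1 b.2) = true) : ∀ b ∈ L, semOKHQ μ b.1 b.2 = true := fun b hb =>
  semOKHQ_of_fatLeafOK (List.all_eq_true.1 h b hb)

/-! ## §4. ONE thin certificate, MANY cheap cells (append edition, critic row 1530 perf note: the thin certificate costs ≈ 50–60 s of kernel time
and must not be re-evaluated per fat cell) -/

/-- The CHEAP per-cell part of the fat leaf: `U`-containment ∧ ξ-collar (no thin certificate). -/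
def fatCellOK (c₀ w₀ : (Fin 3 × Fin 3) ⊕ Fin 3 → ℤ) (ρS : ℤ) (c w : (Fin 3 × Fin 3) ⊕ Fin 3 → ℤ) : Bool :=
  uContained c₀ w₀ c w && xiCollarOK c₀ w₀ ρS c w

/-- ★ **ONE THIN CERTIFICATE + A LIST OF CHEAP CELL TESTS**: `fitOKHDCRSρ c₀ w₀ q ρS e0S` evaluated ONCE, then `fatCellOK` on every listed fat cell. -/
def fatLeavesOK (c₀ w₀ : (Fin 3 × Fin 3) ⊕ Fin 3 → ℤ) (q : Fin 4 → ℤ) (ρS e0S : ℤ)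
    (L : List (((Fin 3 × Fin 3) ⊕ Fin 3 → ℤ) × ((Fin 3 × Fin 3) ⊕ Fin 3 → ℤ))) : Bool :=
  fitOKHDCRSρ c₀ w₀ q ρS e0S && L.all fun b => fatCellOK c₀ w₀ ρS b.1 b.2

/-- The fat leaf from its two parts. [formal bookkeeping] -/
theorem fatLeafOK_of_parts {c₀ w₀ c w : (Fin 3 × Fin 3) ⊕ Fin 3 → ℤ} {q : Fin 4 → ℤ} {ρS e0S : ℤ}
    (hcert : fitOKHDCRSρ c₀ w₀ q ρS e0S = true) (hcell : fatCellOK c₀ w₀ ρS c w = true) : fatLeafOK c₀ w₀ q ρS e0S c w = true := by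
  simp only [fatCellOK, Bool.and_eq_true] at hcell
  simp only [fatLeafOK, Bool.and_eq_true]
  exact ⟨⟨hcell.1, hcell.2⟩, hcert⟩

/-- ★★ **A WHOLE LIST OF FAT CELLS OVER ONE THIN CERTIFICATE, the certificate evaluated once**: `fatLeavesOK … L = true` (ONE `decide`, kernel cost ≈
one thin certificate + a few comparisons per cell) ⟹ every listed cell is a `semOKHQ` fact at every level. [formal bookkeeping] -/
theorem semFactsQ_of_fatLeavesOK {μ : ℤ} {c₀ w₀ : (Fin 3 × Fin 3) ⊕ Fin 3 → ℤ} {q : Fin 4 → ℤ} {ρS e0S : ℤ}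
    {L : List (((Fin 3 × Fin 3) ⊕ Fin 3 → ℤ) × ((Fin 3 × Fin 3) ⊕ Fin 3 → ℤ))}
    (h : fatLeavesOK c₀ w₀ q ρS e0S L = true) : ∀ b ∈ L, semOKHQ μ b.1 b.2 = true := by
  simp only [fatLeavesOK, Bool.and_eq_true] at h
  exact fun b hb => semOKHQ_of_fatLeafOK (fatLeafOK_of_parts h.1 (List.all_eq_true.1 h.2 b hb))

end Summit.AtomisticToContinuum.Crystallization.Theorems.FrustratedLawDichotomyStrainedPatchHomEntryFitHcpFatLeaf

end
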